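import Summits.CriticalPhenomena.PercolationContinuityZ3.Theorems.PercNearOneGluingAdditiveGluingKnLemma3Mixed
import HarnessLib

/-! # Crux `PercNearOneGluing.AdditiveGluing` (stmt-CriticalPhenomena-4576), line `starglue/tieline`
— atom `stub_exchangeAvoid_c7`: the Kozma–Nitzan Lemma 3(ii) exchange given `o ∉ C(x)`

If `μ(x ↔ b) ≤ μ(y ↔ b)` then `μ(x ↔ b, x ↮ y, x ↮ o) ≤ μ(y ↔ b, x ↮ y, x ↮ o)`.

Proof: the event `Q = {x ↮ y} ∩ {x ↮ o}` is a decreasing function of the open edge cluster `C_x`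
(if `C_x ω' ⊆ C_x ω` and `x` reaches neither `y` nor `o` in `ω`, then it reaches neither in `ω'`,
by `reachable_iff_exists_mem_openEdgeCluster`), hence mixed-monotone in the sense of the landed
`knLemma3Mixed` (Kozma–Nitzan, arXiv:2401.12397, Lemma 3, pp. 6–7, via van den Berg–Häggström–Kahn
2006 Thm. 1.5), which with `a₁ = x`, `a₂ = y`, `d = 0` gives
`μ({x ↔ b} ∩ Q) ≤ μ({y ↔ b} ∩ Q)`; reassociating the intersections is the claim.
-/

namespace Summit.CriticalPhenomena.PercolationContinuityZ3.Theorems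

open MeasureTheory Set Literature.Probability.LatticeModels Literature.Probability.Percolation

noncomputable section
open Classical

/-- `{x ↮ y} ∩ {x ↮ o}` is decreasing in the open edge cluster of `x` (and trivially increasing in
that of `y`): the mixed-monotonicity hypothesis of `knLemma3Mixed` for this event. [folklore] -/
theorem exchangeAvoid_mixedMono {n : ℕ} (x y o : Fin n) :
    ∀ ω ω' : BondConfig (Fin n), ω ∈ ((openConn x y)ᶜ ∩ (openConn x o)ᶜ : Set (BondConfig (Fin n))) →
      openEdgeCluster ω y ⊆ openEdgeCluster ω' y →
      openEdgeCluster ω' x ⊆ openEdgeCluster ω x →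
      ω' ∈ ((openConn x y)ᶜ ∩ (openConn x o)ᶜ : Set (BondConfig (Fin n))) := by
  rintro ω ω' ⟨hxy, hxo⟩ _ h1
  refine ⟨fun hr => hxy ?_, fun hr => hxo ?_⟩
  · rcases (reachable_iff_exists_mem_openEdgeCluster ω' x y).1 hr with rfl | ⟨e, he, hye⟩
    · exact SimpleGraph.Reachable.refl _
    · exact (reachable_iff_exists_mem_openEdgeCluster ω x _).2 (Or.inr ⟨e, h1 he, hye⟩)
  · rcases (reachable_iff_exists_mem_openEdgeCluster ω' x o).1 hr with rfl | ⟨e, he, hoe⟩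
    · exact SimpleGraph.Reachable.refl _
    · exact (reachable_iff_exists_mem_openEdgeCluster ω x _).2 (Or.inr ⟨e, h1 he, hoe⟩)

/-- **Exchange given `o ∉ C(x)`** (two-sided Kozma–Nitzan Lemma 3(ii), `Q = {x ↮ y} ∩ {x ↮ o}`
decreasing in `C_x`): if `μ(x ↔ b) ≤ μ(y ↔ b)` then
`μ(x ↔ b, x ↮ y, x ↮ o) ≤ μ(y ↔ b, x ↮ y, x ↮ o)`.
[cite: KozmaNitzan2024, Lemma 3(ii) (pp. 6–7)] -/
theorem stub_exchangeAvoid_c7 : ∀ (n : ℕ) (w : Sym2 (Fin n) → unitInterval) (x y o b : Fin n),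
    (prodBernoulli w).real (openConn x b) ≤ (prodBernoulli w).real (openConn y b) →
    (prodBernoulli w).real (openConn x b ∩ (openConn x y)ᶜ ∩ (openConn x o)ᶜ) ≤
      (prodBernoulli w).real (openConn y b ∩ (openConn x y)ᶜ ∩ (openConn x o)ᶜ) := by
  intro n w x y o b hle
  have h := knLemma3Mixed n w x y b ((openConn x y)ᶜ ∩ (openConn x o)ᶜ) 0
    (exchangeAvoid_mixedMono x y o) le_rfl (by rw [add_zero]; exact hle)
  rw [add_zero, ← Set.inter_assoc, ← Set.inter_assoc] at h
  exact h

end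

end Summit.CriticalPhenomena.PercolationContinuityZ3.Theorems
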